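import Literature.NumberTheory.LFunctions.ZetaZeroReciprocalSumsExplicit
import Literature.NumberTheory.LFunctions.ZetaZeroDensityExplicit
import HarnessLib

/-!
# RH-FREE — `s₀(σ,U,V) = Σ_{β≥σ, U<γ≤V} 1/γ ≤ B₀(σ,U,V)` from the explicit zero-density tables of Fiori–Kadiri–Swidinsky 2023 and Johnston–Yang 2023 («nothing here bears on the truth of RH»)

Topic `Literature/NumberTheory/LFunctions` (RH literature-typing tranche 1, L4 "explicit zero
statistics", gen 5). THEOREMS only (no definitions, no named facts). Nothing here bears on the
truth of RH.

Fiori–Kadiri–Swidinsky (J. Math. Anal. Appl. 527 (2023) 127426), §2.2, after Lemma 2.5: "To apply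
the above we use the functions `Ñ` obtained in Kadiri–Lumley–Ng's Theorem 1.1" — Theorem 2.7 /
Table 5 and Corollary 2.9 / Table 6 (typed in `ZetaZeroDensityExplicit.lean` as the named facts
`FioriKadiriSwidinsky2023_table5`, `FioriKadiriSwidinsky2023_table6`; Johnston–Yang's re-computation
`JohnstonYang2023_table3` has the same shape). Their majorant
`inghamBound c₁ c₂ σ T = c₁ T^{8(1−σ)/3} (log T)^{5−2σ} + c₂ (log T)²` IS the (ZDB) majorant
`FKS2023.zdbMajorant c₁ c₂ (8(1−σ)/3) (5−2σ) T` of Lemma 2.5 (`inghamBound_eq_zdbMajorant`, `rfl`),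
with `0 < p = 8(1−σ)/3 < 1` exactly for `5/8 < σ < 1` (the printed hypothesis `σ ≥ 5/8` of Lemma 2.5)
and `q = 5 − 2σ > 0`. Hence (PROVED, from the respective table fact and the tree theorem
`sum_inv_le_B₀_of_countRe` = FKS Lemma 2.5):

* `FioriKadiriSwidinsky2023_table5.sum_inv_le_B₀` — for each row `(σ, c₁, c₂)` of Table 5 with
  `5/8 < σ`, and `H₀ = 3·10¹² ≤ U ≤ V`: `Σ_{β≥σ, U<γ≤V} m(ρ)/γ ≤ B₀(c₁, c₂, 8(1−σ)/3, 5−2σ; U, V)`;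
* `FioriKadiriSwidinsky2023_table6.sum_inv_le_B₀` — the same for each row `(σ₁, σ₂, c̃₁, c̃₂)` of
  Table 6 and every `σ ∈ [σ₁, σ₂]` with `5/8 < σ < 1` (piecewise-constant `c₁(σ), c₂(σ)`, exponents
  at `σ` — the form used in FKS §3);
* `KadiriLumleyNg2018_table1.sum_inv_le_B₀` — for each row `(σ₀, k, A, B)` of KLN's Table 1 with
  `σ₀ > 5/8`, every `σ > σ₀`, `KLN2018.H₀ = 30 610 046 000 ≤ U ≤ V` (`(log kT)^{2σ₀} ≤ (log T)^{2σ₀}` as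
  `k ≤ 1`, `inghamKLNBound_le_zdbMajorant`).
* `JohnstonYang2023_table3.sum_inv_le_B₀` — for each row `(σ₀, C₁, C₂)` of JY's Table 3, every
  `σ > σ₀` and `H₀ = 3 000 175 332 800 ≤ U ≤ V` (exponents at `σ₀ ∈ [0.98, 0.999]`).

## References

* A. Fiori, H. Kadiri, J. Swidinsky, J. Math. Anal. Appl. 527 (2023) 127426 (arXiv:2204.02588v3),
  Lemma 2.5 (eqs. (2.9)–(2.10)), Thm. 2.7, Cor. 2.9 (eq. (2.17)), and the two zero-density tables —
  "Table 5"/"Table 6" in the names and cites of the tree's facts `FioriKadiriSwidinsky2023_table5/6`,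
  Tables 7–8 of the compiled arXiv v3 (numbering audited 2026-08-27; theorem-like items share one
  counter, so the `B₀` lemma is Lemma 2.5 — the tree's `FioriKadiriSwidinsky2023_lemma24` keeps an
  earlier label). [FioriKadiriSwidinsky2023]
* H. Kadiri, A. Lumley, N. Ng, *Explicit zero density for the Riemann zeta function*, J. Math.
  Anal. Appl. 465 (2018) 22–46, Thm. 1.1, §5 Table 1. [KadiriLumleyNg2018]
* D. R. Johnston, A. Yang, J. Math. Anal. Appl. 527 (2023) 127460, Lemma 2.6, Table 3.
  [JohnstonYang2023]
-/

noncomputable section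

open Complex Filter Set
open scoped Real

namespace Literature.NumberTheory.LFunctions

open SchoenfeldBound

/-- The Ingham-type majorant of the density tables is the (ZDB) majorant of Lemma 2.5 with
`p = 8(1−σ)/3`, `q = 5 − 2σ`. [cite: FioriKadiriSwidinsky2023, Cor. 2.9 eq. (2.17) and §2.2 eq. (2.6)] -/
theorem inghamBound_eq_zdbMajorant (c₁ c₂ σ T : ℝ) :
    inghamBound c₁ c₂ σ T = FKS2023.zdbMajorant c₁ c₂ (8 / 3 * (1 - σ)) (5 - 2 * σ) T := rfl

/-- The table majorants satisfy the exponent hypotheses of Lemma 2.5 exactly on `5/8 < σ < 1`: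
`0 < 8(1−σ)/3 < 1` and `0 < 5 − 2σ`. [cite: FioriKadiriSwidinsky2023, Lemma 2.5 (hypothesis σ ≥ 5/8)] -/
theorem zdb_exponents_of_lt_of_lt {σ : ℝ} (h1 : 5 / 8 < σ) (h2 : σ < 1) :
    0 < 8 / 3 * (1 - σ) ∧ 8 / 3 * (1 - σ) < 1 ∧ 0 < 5 - 2 * σ := by
  refine ⟨by linarith, by linarith, by linarith⟩

namespace FioriKadiriSwidinsky2023_table5

/-- **`s₀(σ,U,V) ≤ B₀(σ,U,V)` from Table 5** (Lemma 2.5 applied to Theorem 2.7's majorant): for each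
row `(σ, c₁, c₂)` of Table 5 with `σ > 5/8` (all rows but `σ = 0.6`), and `H₀ = 3·10¹² ≤ U ≤ V`,
`Σ_{β≥σ, U<γ≤V} m(ρ)/γ ≤ B₀(c₁, c₂, 8(1−σ)/3, 5−2σ; U, V)`.
[cite: FioriKadiriSwidinsky2023, Lemma 2.5 with Thm. 2.7 / Table 5] -/
theorem sum_inv_le_B₀ (h : FioriKadiriSwidinsky2023_table5) {σ c₁ c₂ : ℝ}
    (hrow : (σ, c₁, c₂) ∈ FKS2023.table5) (hσ : 5 / 8 < σ) (hσ1 : σ < 1) {U V : ℝ}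
    (hU : FKS2023.H₀ ≤ U) (hUV : U ≤ V) :
    ∑ ρ ∈ zerosBetweenRe σ U V, (riemannZetaZeroOrder ρ : ℝ) * (1 / ρ.im) ≤
      FKS2023.B₀ c₁ c₂ (8 / 3 * (1 - σ)) (5 - 2 * σ) U V := by
  obtain ⟨hp, hp1, hq⟩ := zdb_exponents_of_lt_of_lt hσ hσ1
  have hH : (2 : ℝ) ≤ FKS2023.H₀ := by norm_num [FKS2023.H₀]
  refine sum_inv_le_B₀_of_countRe hH hp hp1 hq (fun T hT ↦ ?_) hU hUV
  rw [← inghamBound_eq_zdbMajorant]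
  exact h σ c₁ c₂ hrow T hT

/-- The row `σ = 0.99` of Table 5: for `3·10¹² ≤ U ≤ V`,
`Σ_{β≥0.99, U<γ≤V} m(ρ)/γ ≤ B₀(16.8481, 2.1648, 8·0.01/3, 3.02; U, V)`.
[cite: FioriKadiriSwidinsky2023, Lemma 2.5 with Table 5 (row σ = 0.990)] -/
theorem sum_inv_le_B₀_row_099 (h : FioriKadiriSwidinsky2023_table5) {U V : ℝ}
    (hU : FKS2023.H₀ ≤ U) (hUV : U ≤ V) :
    ∑ ρ ∈ zerosBetweenRe 0.990 U V, (riemannZetaZeroOrder ρ : ℝ) * (1 / ρ.im) ≤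
      FKS2023.B₀ 16.8481 2.1648 (8 / 3 * (1 - 0.990)) (5 - 2 * 0.990) U V := by
  have hrow : ((0.990 : ℝ), (16.8481 : ℝ), (2.1648 : ℝ)) ∈ FKS2023.table5 := by
    simp [FKS2023.table5]
  exact sum_inv_le_B₀ h hrow (by norm_num) (by norm_num) hU hUV

end FioriKadiriSwidinsky2023_table5

namespace FioriKadiriSwidinsky2023_table6

/-- **`s₀(σ,U,V) ≤ B₀(σ,U,V)` from Table 6** (Lemma 2.5 applied to Corollary 2.9's piecewise-constant
majorant, the form used in FKS §3): for each row `(σ₁, σ₂, c̃₁, c̃₂)` of Table 6, every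
`σ ∈ [σ₁, σ₂]` with `5/8 < σ < 1`, and `H₀ = 3·10¹² ≤ U ≤ V`,
`Σ_{β≥σ, U<γ≤V} m(ρ)/γ ≤ B₀(c̃₁, c̃₂, 8(1−σ)/3, 5−2σ; U, V)`.
[cite: FioriKadiriSwidinsky2023, Lemma 2.5 with Cor. 2.9 / Table 6] -/
theorem sum_inv_le_B₀ (h : FioriKadiriSwidinsky2023_table6) {σ₁ σ₂ c₁ c₂ : ℝ}
    (hrow : (σ₁, σ₂, c₁, c₂) ∈ FKS2023.table6) {σ : ℝ} (h1 : σ₁ ≤ σ) (h2 : σ ≤ σ₂)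
    (hσ : 5 / 8 < σ) (hσ1 : σ < 1) {U V : ℝ} (hU : FKS2023.H₀ ≤ U) (hUV : U ≤ V) :
    ∑ ρ ∈ zerosBetweenRe σ U V, (riemannZetaZeroOrder ρ : ℝ) * (1 / ρ.im) ≤
      FKS2023.B₀ c₁ c₂ (8 / 3 * (1 - σ)) (5 - 2 * σ) U V := by
  obtain ⟨hp, hp1, hq⟩ := zdb_exponents_of_lt_of_lt hσ hσ1
  have hH : (2 : ℝ) ≤ FKS2023.H₀ := by norm_num [FKS2023.H₀]
  refine sum_inv_le_B₀_of_countRe hH hp hp1 hq (fun T hT ↦ ?_) hU hUV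
  rw [← inghamBound_eq_zdbMajorant]
  exact h σ₁ σ₂ c₁ c₂ hrow σ T h1 h2 hT

end FioriKadiriSwidinsky2023_table6

namespace JohnstonYang2023_table3

/-- **`s₀(σ,U,V) ≤ B₀` from Johnston–Yang's Table 3**: for each row `(σ₀, C₁, C₂)` (`σ₀ ∈
[0.98, 0.999]`), every `σ > σ₀`, and `H₀ = 3 000 175 332 800 ≤ U ≤ V`,
`Σ_{β≥σ, U<γ≤V} m(ρ)/γ ≤ B₀(C₁, C₂, 8(1−σ₀)/3, 5−2σ₀; U, V)` (exponents at the tabulated `σ₀`).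
[cite: JohnstonYang2023, Lemma 2.6 and Table 3] [cite: FioriKadiriSwidinsky2023, Lemma 2.5] -/
theorem sum_inv_le_B₀ (h : JohnstonYang2023_table3) {σ₀ C₁ C₂ : ℝ}
    (hrow : (σ₀, C₁, C₂) ∈ JY2023.table3) {σ : ℝ} (hσ : σ₀ < σ) {U V : ℝ}
    (hU : JY2023.H₀ ≤ U) (hUV : U ≤ V) :
    ∑ ρ ∈ zerosBetweenRe σ U V, (riemannZetaZeroOrder ρ : ℝ) * (1 / ρ.im) ≤
      FKS2023.B₀ C₁ C₂ (8 / 3 * (1 - σ₀)) (5 - 2 * σ₀) U V := by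
  have hσ₀ : 5 / 8 < σ₀ ∧ σ₀ < 1 := by
    simp only [JY2023.table3, List.mem_cons, Prod.mk.injEq, List.not_mem_nil, or_false] at hrow
    rcases hrow with ⟨rfl, -⟩ | ⟨rfl, -⟩ | ⟨rfl, -⟩ | ⟨rfl, -⟩ | ⟨rfl, -⟩ | ⟨rfl, -⟩ | ⟨rfl, -⟩ |
      ⟨rfl, -⟩ | ⟨rfl, -⟩ | ⟨rfl, -⟩ | ⟨rfl, -⟩ | ⟨rfl, -⟩ | ⟨rfl, -⟩ | ⟨rfl, -⟩ | ⟨rfl, -⟩ |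
      ⟨rfl, -⟩ | ⟨rfl, -⟩ | ⟨rfl, -⟩ | ⟨rfl, -⟩ | ⟨rfl, -⟩ <;> norm_num
  obtain ⟨hp, hp1, hq⟩ := zdb_exponents_of_lt_of_lt hσ₀.1 hσ₀.2
  have hH : (2 : ℝ) ≤ JY2023.H₀ := by norm_num [JY2023.H₀]
  refine sum_inv_le_B₀_of_countRe hH hp hp1 hq (fun T hT ↦ ?_) hU hUV
  rw [← inghamBound_eq_zdbMajorant]
  exact h σ₀ C₁ C₂ hrow σ T hσ hT

end JohnstonYang2023_table3

/-! ## Kadiri–Lumley–Ng 2018, Table 1 -/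

/-- For `0 < k ≤ 1`, `kT ≥ 1`, `T > 1`, `A ≥ 0`: KLN's bound is at most the (ZDB) majorant with the
same constants, `A (log kT)^{2σ₀} (log T)^{5−4σ₀} T^{8(1−σ₀)/3} + B log²T ≤ A T^{8(1−σ₀)/3} (log T)^{5−2σ₀}
+ B log²T` (`log(kT) ≤ log T`). [cite: KadiriLumleyNg2018, Thm. 1.1 eq. (1.8)] -/
theorem inghamKLNBound_le_zdbMajorant {A B σ₀ k T : ℝ} (hA : 0 ≤ A) (hσ₀ : 0 ≤ σ₀) (hk : k ≤ 1)
    (hkT : 1 ≤ k * T) (hT : 1 < T) :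
    inghamKLNBound A B σ₀ k T ≤ FKS2023.zdbMajorant A B (8 / 3 * (1 - σ₀)) (5 - 2 * σ₀) T := by
  unfold inghamKLNBound FKS2023.zdbMajorant
  have hT0 : 0 < T := by linarith
  have hlogT : 0 < Real.log T := Real.log_pos hT
  have hlogk0 : 0 ≤ Real.log (k * T) := Real.log_nonneg hkT
  have hlogk : Real.log (k * T) ≤ Real.log T :=
    Real.log_le_log (by linarith) (by nlinarith)
  have h1 : Real.log (k * T) ^ (2 * σ₀) ≤ Real.log T ^ (2 * σ₀) :=
    Real.rpow_le_rpow hlogk0 hlogk (by linarith)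
  have h2 : Real.log T ^ (2 * σ₀) * Real.log T ^ (5 - 4 * σ₀) = Real.log T ^ (5 - 2 * σ₀) := by
    rw [← Real.rpow_add hlogT]; ring_nf
  have h3 : 0 ≤ Real.log T ^ (5 - 4 * σ₀) * T ^ (8 / 3 * (1 - σ₀)) := by positivity
  calc A * Real.log (k * T) ^ (2 * σ₀) * Real.log T ^ (5 - 4 * σ₀) * T ^ (8 / 3 * (1 - σ₀))
        + B * Real.log T ^ 2
      = A * (Real.log (k * T) ^ (2 * σ₀) * (Real.log T ^ (5 - 4 * σ₀) * T ^ (8 / 3 * (1 - σ₀))))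
        + B * Real.log T ^ 2 := by ring
    _ ≤ A * (Real.log T ^ (2 * σ₀) * (Real.log T ^ (5 - 4 * σ₀) * T ^ (8 / 3 * (1 - σ₀))))
        + B * Real.log T ^ 2 := by
          gcongr
    _ = A * T ^ (8 / 3 * (1 - σ₀)) * Real.log T ^ (5 - 2 * σ₀) + B * Real.log T ^ 2 := by
          rw [← h2]; ring

namespace KadiriLumleyNg2018_table1

/-- **`s₀(σ,U,V) ≤ B₀` from Kadiri–Lumley–Ng's Table 1** (FKS: "To apply the above we use the
functions `Ñ` … These can be obtained in Kadiri–Lumley–Ng's [KLN18, Theorem 1.1]"): for each row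
`(σ₀, k, A, B)` with `σ₀ > 5/8` (all rows but `σ₀ = 0.60`), every `σ > σ₀`, and
`H₀ = 30 610 046 000 ≤ U ≤ V`, `Σ_{β≥σ, U<γ≤V} m(ρ)/γ ≤ B₀(A, B, 8(1−σ₀)/3, 5−2σ₀; U, V)`.
[cite: KadiriLumleyNg2018, Thm. 1.1 and §5 Table 1] [cite: FioriKadiriSwidinsky2023, Lemma 2.5] -/
theorem sum_inv_le_B₀ (h : KadiriLumleyNg2018_table1) {σ₀ k A B : ℝ}
    (hrow : (σ₀, k, A, B) ∈ KLN2018.table1) (hσ₀ : 5 / 8 < σ₀) {σ : ℝ} (hσ : σ₀ < σ) {U V : ℝ}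
    (hU : KLN2018.H₀ ≤ U) (hUV : U ≤ V) :
    ∑ ρ ∈ zerosBetweenRe σ U V, (riemannZetaZeroOrder ρ : ℝ) * (1 / ρ.im) ≤
      FKS2023.B₀ A B (8 / 3 * (1 - σ₀)) (5 - 2 * σ₀) U V := by
  have hrow' : σ₀ < 1 ∧ 1 / 2 ≤ k ∧ k ≤ 1 ∧ 0 ≤ A := by
    simp only [KLN2018.table1, List.mem_cons, Prod.mk.injEq, List.not_mem_nil, or_false] at hrow
    rcases hrow with ⟨rfl, rfl, rfl, -⟩ | ⟨rfl, rfl, rfl, -⟩ | ⟨rfl, rfl, rfl, -⟩ | ⟨rfl, rfl, rfl, -⟩ |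
      ⟨rfl, rfl, rfl, -⟩ | ⟨rfl, rfl, rfl, -⟩ | ⟨rfl, rfl, rfl, -⟩ | ⟨rfl, rfl, rfl, -⟩ |
      ⟨rfl, rfl, rfl, -⟩ | ⟨rfl, rfl, rfl, -⟩ | ⟨rfl, rfl, rfl, -⟩ | ⟨rfl, rfl, rfl, -⟩ |
      ⟨rfl, rfl, rfl, -⟩ | ⟨rfl, rfl, rfl, -⟩ | ⟨rfl, rfl, rfl, -⟩ | ⟨rfl, rfl, rfl, -⟩ |
      ⟨rfl, rfl, rfl, -⟩ | ⟨rfl, rfl, rfl, -⟩ | ⟨rfl, rfl, rfl, -⟩ | ⟨rfl, rfl, rfl, -⟩ <;> norm_num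
  obtain ⟨hσ₀1, hk, hk1, hA⟩ := hrow'
  obtain ⟨hp, hp1, hq⟩ := zdb_exponents_of_lt_of_lt hσ₀ hσ₀1
  have hH : (2 : ℝ) ≤ KLN2018.H₀ := by norm_num [KLN2018.H₀]
  refine sum_inv_le_B₀_of_countRe hH hp hp1 hq (fun T hT ↦ ?_) hU hUV
  have hT1 : (1 : ℝ) < T := by norm_num [KLN2018.H₀] at hT; linarith
  have hkT : 1 ≤ k * T := by norm_num [KLN2018.H₀] at hT; nlinarith
  exact (h σ₀ k A B hrow σ T hσ hT).trans
    (inghamKLNBound_le_zdbMajorant hA (by linarith) hk1 hkT hT1)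

end KadiriLumleyNg2018_table1

end Literature.NumberTheory.LFunctions

end
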